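import Summits.QuantumFields.BalabanUV.Beta.GAN24.ChargeTowerStep

/-!
# `BalabanUV.Beta.GAN24.QuarticPushColumnCharge` — binder row G-an2-4 ∕ (CONV-C), row (C) at the levels `j ≥ 1`, CONTACT side; Part 25 of
# `GAN24/FourFaceGaugeSectors`: **THE ONE-LEG CHARGE OF A CO-DRESSED SANDWICH WITH THE OTHER COARSE LEG OPEN** — for ANY localised interior `V`, bounded `f : ℤ → ℝ`,
# and a FIXED coarse column `(Lc•z₀, inr γ)`:
# `Σ'_{x} f(x_α)·(G_j∘V∘G_j)(Lc•x, Lc•z₀)(inr α, inr γ) = −cH_j·Σ'_{(y,w)} 𝟙[y_α % Lc = Lc−1]·f((blk y)_α)·Σ_g V y w (inl α) g·G_j w (Lc•z₀) g (inr γ)`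
# — the weighted leg lands on the exit faces of the interior's left field leg; the open leg stays a COLUMN of `G_j` (the brick for chaining the words `dM_b∘G_j∘dM_{b′}` of the
# order-2 interior through the lower propagator, where a lower cubic member `e3OfK G_{j−1} …` has one leg summed against an exit weight and the other contracted onward)

NOT IN PRINT; OUR BOOKKEEPING (G-an2-4 crux team (2), leaf prover `b2b-balaban-gan24-formalise-leaf-02`, gen 66).  WHY.  In the order-2 leg tower (memo
`HOME/…/leaf-02/g66/CT-VALUES-PLAN-v0.md` §5) the interior's words chain first-order vertices through `G_j`: `(dM_b∘G_j∘dM_{b′})(y,w)` with `y` against an exit weight and the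
inner legs contracted; a vertex's stencil `SpureRecAt j l t = (cE wE_j)•e3OfK G_{j−1} (SrecAt (j−1)) l t + …` is itself a co-dressed sandwich one level down whose OTHER leg is then
NOT summed against a weight but left open (a coarse multiplier leg = a column of `G_{j−1}`).  road-P2's two-sided read-out `ChargeTowerLegs.hasSum_sandwich_readout_two` gives this
one-sided statement for free: take the right kernel to be `G_j` RESTRICTED to the column `q = Lc•z₀` (a weight on the second index, `ChargeTowerStep.comp_weighted_right`), whose
coarse-column charge is the single entry `G_j w (Lc•z₀) g (inr γ)` (`hasSum_ite_eq`); the product `HasSum` is supported on the slice `z = z₀` and restricts to the fibre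
(`Function.Injective.hasSum_iff`).  No new summability estimate.

WHAT (every `j`, in-block root `ρ = toSite r`, `G_j = coDressKBmAt ρ Lc (KInvStep Lc j)`, `cH_j = (stepScale_j·Lc^{d+1})⁻¹`; [folklore] BY NAME over road-P2's `ChargeTowerLegs` ∕ `ChargeTowerStep`;
0 `def`, 0 cited facts, 0 `def … : Prop`, 0 sorry):
* §1 `zsmul_eq_zsmul_iff` (`Lc•z = Lc•z₀ ↔ z = z₀`), `sum_coord_kron_left` (the fibre sum at the row charge: only `f = inl α` survives);
* §2 **`hasSum_coordWeighted_sandwich_col`** — the displayed identity (generic `Loc V`).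
HONEST FRAMING (cell contract, verbatim): «discharging `BetaPertH` makes Bałaban's UV stability UNCONDITIONAL — a real constructive-QFT result; it is NOT the continuum limit and
NOT the Clay problem.»  HONEST DEPENDENCY (verbatim): «continuum YM on T⁴ ⇐ BetaPertH ∧ nine spine estimates (0/9 proved); BetaPertH ⇐ (D1) ∧ (D4) ∧ CAP+tail; G-an2-4
gates asym, D1 and NE2/3/4.»  Asserts NO value of any resolvent column beyond road-P2 g41's weighted coarse-row charges (d1-leaf-07's ∕ an1's column laws); NOTHING of (C) at j ≥ 1 ∕
(C)sym ∕ (Q-L) ∕ (FL) ∕ «T2Shape» ∕ «T2Drift» ∕ (hW, hWall) discharged; NEVER «G-an2-4 closed» as (CONV-C); NOT D1, NOT `BetaPertH`, NOT continuum, NOT Clay.  2026-08-23; no existing file touched.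
-/

noncomputable section

open Finset
open scoped BigOperators
open Literature.MathematicalPhysics.QuantumFieldTheory
open Literature.MathematicalPhysics.QuantumFieldTheory.Balaban1983to89
open Literature.MathematicalPhysics.QuantumFieldTheory.Balaban1983to89.Beta
open ExpKernelCalculus (Site MKer BiLoc Decays comp)
open OneStepResolventKernel (Fib)
open AffineAveraging (box toSite)
open AveragingContours (blk)
open AxialProjector (blk_zsmul)
open OneStepKernelFamily (KInvStep decays_KInvStep)
open Summit.QuantumFields.BalabanUV.Beta.TameKernelCalculus
open Summit.QuantumFields.BalabanUV.Beta.AxialDressingRooted (coDressKBmAt decays_coDressKBmAt)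
open Summit.QuantumFields.BalabanUV.Beta.BorderedHessian (stepScale)
open Summit.QuantumFields.BalabanUV.Beta.GAN24.ChargeTowerLegs (hasSum_sandwich_readout_two hasSum_row_coord_inl hasSum_row_coord_inr)
open Summit.QuantumFields.BalabanUV.Beta.GAN24.ChargeTowerStep (comp_weighted_left comp_weighted_right)

namespace Summit.QuantumFields.BalabanUV.Beta.GAN24.QuarticPushColumnCharge

variable {d : ℕ} {Lc : ℕ} [NeZero Lc] {r : Fin (d + 1) → ℕ}

/-! ## §1 Two pieces of bookkeeping -/

omit [NeZero Lc] in
/-- [folklore] Dilation by a nonzero integer is injective on the lattice: `Lc•z = Lc•z₀ ↔ z = z₀` for `1 ≤ Lc`. -/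
theorem zsmul_eq_zsmul_iff (hLc : 1 ≤ Lc) (z z₀ : Site (d + 1)) : (Lc : ℤ) • z = (Lc : ℤ) • z₀ ↔ z = z₀ := by
  refine ⟨fun h => ?_, fun h => by rw [h]⟩
  have hc : (Lc : ℤ) ≠ 0 := by exact_mod_cast (Nat.one_le_iff_ne_zero.1 hLc)
  exact smul_right_injective (Fin (d + 1) → ℤ) hc h

/-- [folklore] Folding the fibre sum at road-P2's weighted row charge: only `f = inl α` survives —
`Σ_f (Sum.elim (κ ↦ −(c·𝟙[κ = α ∧ P]·a)) 0 f)·W f = −(c·(𝟙[P]·a·W (inl α)))`. -/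
theorem sum_coord_kron_left (c a : ℝ) (W : Fib d → ℝ) (α : Fin (d + 1)) (P : Prop) [Decidable P] :
    ∑ f : Fib d, Sum.elim (fun κ : Fin (d + 1) => -(c * (if κ = α ∧ P then a else 0))) (fun _ => (0 : ℝ)) f * W f
      = -(c * (if P then a * W (Sum.inl α) else 0)) := by
  rw [Fintype.sum_sum_type]
  have h2 : ∑ m : Fin (d + 1), Sum.elim (fun κ : Fin (d + 1) => -(c * (if κ = α ∧ P then a else 0))) (fun _ => (0 : ℝ)) (Sum.inr m) * W (Sum.inr m) = 0 :=
    Finset.sum_eq_zero fun m _ => by simp only [Sum.elim_inr, zero_mul]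
  rw [h2, add_zero, Finset.sum_eq_single α (fun κ _ hκ => ?_) (fun h => absurd (Finset.mem_univ α) h)]
  · simp only [Sum.elim_inl, true_and]
    by_cases hP : P
    · rw [if_pos hP, if_pos hP]; ring
    · rw [if_neg hP, if_neg hP]; ring
  · simp only [Sum.elim_inl, if_neg (fun hh : κ = α ∧ P => hκ hh.1), mul_zero, neg_zero, zero_mul]

/-! ## §2 The one-leg charge with the other coarse leg open -/

/-- NOT IN PRINT; OUR BOOKKEEPING.  **THE ONE-LEG CHARGE OF A CO-DRESSED SANDWICH, THE OTHER COARSE LEG OPEN** (every `j`, in-block root, ANY localised `V`, bounded `f : ℤ → ℝ`,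
fixed coarse column `(Lc•z₀, inr γ)`):
`HasSum (x ↦ f(x_α)·(G_j∘V∘G_j)(Lc•x, Lc•z₀)(inr α, inr γ)) (−cH_j·Σ'_{(y,w)} 𝟙[y_α % Lc = Lc−1]·f((blk y)_α)·Σ_g V y w (inl α) g·G_j w (Lc•z₀) g (inr γ))`
— road-P2's two-sided read-out with the right kernel `G_j` restricted to the column `q = Lc•z₀`; the product statement is supported on the slice `z = z₀`. -/
theorem hasSum_coordWeighted_sandwich_col (hr : r ∈ box (d + 1) Lc) (j : ℕ) {V : MKer (d + 1) (Fib d)} (hV : Loc V)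
    (α : Fin (d + 1)) (f : ℤ → ℝ) {B : ℝ} (hf : ∀ s, |f s| ≤ B) (z₀ : Site (d + 1)) (γ : Fin (d + 1)) :
    HasSum (fun x : Site (d + 1) => f (x α) *
        comp (comp (coDressKBmAt (toSite r) Lc (KInvStep (d := d) Lc j)) V) (coDressKBmAt (toSite r) Lc (KInvStep (d := d) Lc j))
          ((Lc : ℤ) • x) ((Lc : ℤ) • z₀) (Sum.inr α) (Sum.inr γ))
      (-((stepScale d Lc j * (Lc : ℝ) ^ (d + 1))⁻¹ *
        ∑' yw : Site (d + 1) × Site (d + 1),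
          (if yw.1 α % (Lc : ℤ) = (Lc : ℤ) - 1 then
            f (blk Lc yw.1 α) * ∑ g : Fib d, V yw.1 yw.2 (Sum.inl α) g * coDressKBmAt (toSite r) Lc (KInvStep (d := d) Lc j) yw.2 ((Lc : ℤ) • z₀) g (Sum.inr γ)
          else 0))) := by
  classical
  have hLc : 1 ≤ Lc := Nat.one_le_iff_ne_zero.2 (NeZero.ne Lc)
  set G : MKer (d + 1) (Fib d) := coDressKBmAt (toSite r) Lc (KInvStep (d := d) Lc j) with hGdef
  set cH : ℝ := (stepScale d Lc j * (Lc : ℝ) ^ (d + 1))⁻¹ with hcH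
  obtain ⟨δ, C, hδ, -, hK⟩ := decays_KInvStep (d := d) (Lc := Lc) j
  obtain ⟨δG, CG, hδG, hCG, hG⟩ := decays_coDressKBmAt hLc hr (K := KInvStep (d := d) Lc j) ⟨δ, C, hδ, hK.nonneg (Sum.inl 0), hK⟩
  obtain ⟨p, q, Cv, δv, hδv, hVb⟩ := hV
  have hB : 0 ≤ B := (abs_nonneg _).trans (hf 0)
  -- left kernel: `f`-weighted `G`; right kernel: `G` restricted to the column `Lc•z₀`
  set ω : Site (d + 1) → ℝ := fun q' => if q' = (Lc : ℤ) • z₀ then 1 else 0 with hωdef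
  have hω : ∀ q', |ω q'| ≤ 1 := fun q' => by
    simp only [hωdef]; split_ifs <;> simp
  set K₁ : MKer (d + 1) (Fib d) := fun p' q' e f' => f (blk Lc p' α) * G p' q' e f' with hK₁def
  set K₂ : MKer (d + 1) (Fib d) := fun p' q' e f' => G p' q' e f' * ω q' with hK₂def
  have hK₁ : Decays K₁ (B * CG) δG := fun p' q' e f' => by
    simp only [hK₁def]
    rw [abs_mul, mul_assoc]
    exact mul_le_mul (hf _) (hG p' q' e f') (abs_nonneg _) hB
  have hK₂ : Decays K₂ CG δG := fun p' q' e f' => by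
    simp only [hK₂def]
    rw [abs_mul]
    calc |G p' q' e f'| * |ω q'| ≤ |G p' q' e f'| * 1 := mul_le_mul_of_nonneg_left (hω q') (abs_nonneg _)
      _ ≤ CG * Real.exp (-δG * B12Sec2to5.l1 (p' - q')) := by rw [mul_one]; exact hG p' q' e f'
  -- the weighted coarse-row charges of `K₁` (road-P2) and the single-entry column charge of `K₂`
  have hrow : ∀ (f' : Fib d) (y : Site (d + 1)), HasSum (fun x' : Site (d + 1) => K₁ ((Lc : ℤ) • x') y (Sum.inr α) f')
      ((fun (f' : Fib d) (y : Site (d + 1)) => Sum.elim (fun κ : Fin (d + 1) => -(cH *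
          (if κ = α ∧ y α % (Lc : ℤ) = (Lc : ℤ) - 1 then f (blk Lc y α) else 0))) (fun _ => (0 : ℝ)) f') f' y) := by
    intro f' y
    have e : ∀ x' : Site (d + 1), K₁ ((Lc : ℤ) • x') y (Sum.inr α) f' = f (x' α) * G ((Lc : ℤ) • x') y (Sum.inr α) f' := fun x' => by
      simp only [hK₁def, blk_zsmul hLc]
    simp only [e]
    rcases f' with κ | m'
    · exact hasSum_row_coord_inl hr j α f hf y κ
    · exact hasSum_row_coord_inr hr j α f hf y m'
  have hcol : ∀ (g : Fib d) (w : Site (d + 1)), HasSum (fun z' : Site (d + 1) => K₂ w ((Lc : ℤ) • z') g (Sum.inr γ))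
      ((fun (g : Fib d) (w : Site (d + 1)) => G w ((Lc : ℤ) • z₀) g (Sum.inr γ)) g w) := by
    intro g w
    have e : ∀ z' : Site (d + 1), K₂ w ((Lc : ℤ) • z') g (Sum.inr γ) = if z' = z₀ then G w ((Lc : ℤ) • z₀) g (Sum.inr γ) else 0 := by
      intro z'
      simp only [hK₂def, hωdef, zsmul_eq_zsmul_iff hLc]
      split_ifs with h
      · rw [h, mul_one]
      · rw [mul_zero]
    simp only [e]
    exact hasSum_ite_eq z₀ _
  have h := hasSum_sandwich_readout_two (N := Lc) hK₁ hK₂ hδG hVb hδv α γ hrow hcol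
  -- fold the fibre sums: only `f' = inl α` survives on the left
  have hval : ∀ yw : Site (d + 1) × Site (d + 1),
      (∑ f' : Fib d, ∑ g : Fib d, Sum.elim (fun κ : Fin (d + 1) => -(cH * (if κ = α ∧ yw.1 α % (Lc : ℤ) = (Lc : ℤ) - 1 then f (blk Lc yw.1 α) else 0)))
          (fun _ => (0 : ℝ)) f' * V yw.1 yw.2 f' g * G yw.2 ((Lc : ℤ) • z₀) g (Sum.inr γ))
        = -(cH * (if yw.1 α % (Lc : ℤ) = (Lc : ℤ) - 1 then
            f (blk Lc yw.1 α) * ∑ g : Fib d, V yw.1 yw.2 (Sum.inl α) g * G yw.2 ((Lc : ℤ) • z₀) g (Sum.inr γ) else 0)) := by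
    intro yw
    have e : ∀ f' : Fib d, (∑ g : Fib d, Sum.elim (fun κ : Fin (d + 1) => -(cH * (if κ = α ∧ yw.1 α % (Lc : ℤ) = (Lc : ℤ) - 1 then f (blk Lc yw.1 α) else 0)))
          (fun _ => (0 : ℝ)) f' * V yw.1 yw.2 f' g * G yw.2 ((Lc : ℤ) • z₀) g (Sum.inr γ))
        = Sum.elim (fun κ : Fin (d + 1) => -(cH * (if κ = α ∧ yw.1 α % (Lc : ℤ) = (Lc : ℤ) - 1 then f (blk Lc yw.1 α) else 0)))
          (fun _ => (0 : ℝ)) f' * ∑ g : Fib d, V yw.1 yw.2 f' g * G yw.2 ((Lc : ℤ) • z₀) g (Sum.inr γ) := fun f' => by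
      rw [Finset.mul_sum]
      exact Finset.sum_congr rfl fun g _ => by ring
    simp only [e]
    rw [sum_coord_kron_left]
  simp only [hval] at h
  rw [tsum_neg, tsum_mul_left] at h
  -- the product statement is supported on the slice `z = z₀`: restrict to the fibre
  have hsupp : ∀ xz : Site (d + 1) × Site (d + 1), xz ∉ Set.range (fun x : Site (d + 1) => (x, z₀)) →
      comp (comp K₁ V) K₂ ((Lc : ℤ) • xz.1) ((Lc : ℤ) • xz.2) (Sum.inr α) (Sum.inr γ) = 0 := by
    intro xz hxz
    have hz : xz.2 ≠ z₀ := by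
      intro hz
      exact hxz ⟨xz.1, by ext1 <;> simp [hz]⟩
    rw [hK₂def, comp_weighted_right, hωdef]
    simp only [zsmul_eq_zsmul_iff hLc, if_neg hz, mul_zero]
  have hinj : Function.Injective (fun x : Site (d + 1) => (x, z₀)) := fun a b hab => (Prod.mk.inj hab).1
  have h2 := (hinj.hasSum_iff hsupp).2 h
  refine h2.congr_fun fun x => ?_
  show f (x α) * comp (comp G V) G ((Lc : ℤ) • x) ((Lc : ℤ) • z₀) (Sum.inr α) (Sum.inr γ)
      = comp (comp K₁ V) K₂ ((Lc : ℤ) • x) ((Lc : ℤ) • z₀) (Sum.inr α) (Sum.inr γ)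
  rw [hK₂def, comp_weighted_right, hK₁def]
  have e1 : comp (fun p' q' e f' => f (blk Lc p' α) * G p' q' e f') V = fun p' q' e f' => f (blk Lc p' α) * comp G V p' q' e f' := by
    funext p' q' e f'; exact comp_weighted_left (fun p' => f (blk Lc p' α)) G V p' q' e f'
  rw [e1, comp_weighted_left, blk_zsmul hLc, hωdef]
  simp only [if_true]
  ring

end Summit.QuantumFields.BalabanUV.Beta.GAN24.QuarticPushColumnCharge

end
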